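/-
Origin: expansion seat `planner-pub-hodgecm-pv06-g6-0`, handover #5 (CLAIM 2026-08-18T13:36:41Z; HANDOVER 2026-08-18T13:47:10Z) md5 ac6c809a2f7063795a9b21255dcd803c (147 l.); imports `Pv06g6.ArchCOrbitTheta` + `Pv06g6.ArchCOrbitSmoke` (TWO rewrites -> `HodgeCM.PerL34.ArchCOrbitTheta` / `HodgeCM.PerL34.ArchCOrbitSmoke`; as-landed md5 363d7cb5a1b914e1821bb5d6b6b23a85), nothing else; lands AFTER #3 b2229bf6 and #4 42d936aa (hold iff either held); kernel smoke leaf (`HOME/pub-hodgecm-pv06-g6/lean/Pv06g6/ArchCOrbitThetaSmoke.lean`, md5 ac6c809a, 147 lines);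
landed by the gen-8 packager in gate run 30 as `HodgeCM/PerL34/ArchCOrbitThetaSmoke.lean` (import ^import Pv06g6\.ArchCOrbitSmoke[ \t]*$→import HodgeCM.PerL34.ArchCOrbitSmoke ×1; import ^import Pv06g6\.ArchCOrbitTheta[ \t]*$→import HodgeCM.PerL34.ArchCOrbitTheta ×1).
-/
/-
  HodgeCM/PerL34/ArchCOrbitThetaSmoke.lean   (origin: pub-hodgecm-pv06-g6, WIP module `Pv06g6.ArchCOrbitThetaSmoke`;
  session planner-pub-hodgecm-pv06-g6-0, DAG-NODE PROVER #06 gen 6; intended final place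
  `HodgeCM/PerL34/ArchCOrbitThetaSmoke.lean`, module `HodgeCM.PerL34.ArchCOrbitThetaSmoke`; TWO import rewrites at
  intake: `import Pv06g6.ArchCOrbitTheta` ↦ `import HodgeCM.PerL34.ArchCOrbitTheta` and
  `import Pv06g6.ArchCOrbitSmoke` ↦ `import HodgeCM.PerL34.ArchCOrbitSmoke` (this seat's RUN-30 rows #4 / #3).)

  # Smoke test: the theta-vector bridge `FockThetaBridge` is consistent and its clause `thetaC1` is PROVABLE with a
  # non-trivial R and a non-zero derivative

  KIND: KERNEL SMOKE TEST.  DOES NOT BELONG TO THE PROOF CHAIN.  Proves nothing about PerL.  Complete proofs; standard axioms.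
  Nothing landed or queued is touched; nothing imports this file.

  §1  Over pv12-g3's linear toy (G = Unit): `Line.thetaBridge := FockThetaBridge.ofOrbit Line.orbitBridge` — the
      operator-norm route to [D5‴] type-checks on a concrete instance; `Line.H_occ_fires_theta`.
  §2  Over the CIRCLE TOY of `ArchCOrbitSmoke` §2 (H = 𝒮 = ℂ, G = Circle, R(g)v = g⁻¹v unitary, ω(g)Φ = gΦ, 𝒯_Φ v = Φv,
      N21 invariance non-trivial, e(s) = exp(is), X = i·id):
      * `CircleToy.hTc` — Φ ↦ 𝒯_Φ is operator-norm continuous, so `CircleToy.thetaBridge := ofSmooth smoothBridge hTc`;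
      * `CircleToy.rieszTheta_circle` — the theta vector of Φ is conj Φ (the CONJUGATE "theta kernel", as the docstring of
        `ArchC.rieszTheta` says: Φ ↦ θ_{Φ,p} is conjugate-linear);
      * `CircleToy.thetaC1_conj` — the [D5‴] clause CONCRETELY: s ↦ R(e(s)) conj φ = e^{-is} conj φ has derivative
        conj(iφ) = −i·conj φ at 0 in L² = ℂ, read off `thetaBridge.thetaC1` (kernel-derived from `smooth` + `hTc` + N21),
        and independently re-proved from `hasDerivAt_coe_exp_mul` (`thetaC1_direct`) — the two agree;
      * `CircleToy.thetaC1_value_ne_zero`, `CircleToy.H_occ_fires_theta`, `nonempty_thetaBridge`.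
-/
import Summits.HodgeConjecture.HodgeCM.PerL34.ArchCOrbitTheta_2
import Summits.HodgeConjecture.HodgeCM.PerL34.ArchCOrbitSmoke_2

set_option autoImplicit false

noncomputable section

open scoped Topology
open Filter

namespace HodgeCM
namespace PerL34
namespace ArchC
namespace OrbitSmoke

open HodgeCM.Prior.Perl34File HodgeCM.Prior.Perl34File.Perl34
open HodgeCM.PerL34.Fock

/-! ## §1  The linear toy: the operator-norm route `ofOrbit` -/

section LineTheta

open AnalyticSmoke (core torus pointed TΦ_one_one)

namespace Line

/-- `FockThetaBridge` over pv12-g3's line, from the orbit bridge by `FockThetaBridge.ofOrbit` (hF ⇒ thetaC1). -/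
def thetaBridge : FockThetaBridge core torus pointed := FockThetaBridge.ofOrbit orbitBridge

/-- (Ported verbatim from the HodgeCMPerL package; no docstring in the source.) -/
theorem nonempty_thetaBridge : Nonempty (FockThetaBridge core torus pointed) := ⟨thetaBridge⟩

/-- (Ported verbatim from the HodgeCMPerL package; no docstring in the source.) -/
theorem thetaBridge_pl : thetaBridge.pl = orbitBridge.pl := (FockThetaBridge.ofOrbit_pl orbitBridge).1

/-- N29's conclusion through the theta bridge of the line (premise `𝒯_1 1 ≠ 0` as in `Line.H_occ_fires`). -/
theorem H_occ_fires_theta : torus.wOccurs () :=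
  thetaBridge.H_occ 1 () ⟨1, Submodule.mem_top, by rw [TΦ_one_one]; exact one_ne_zero⟩

end Line

end LineTheta

/-! ## §2  The circle toy: `thetaC1` with a non-trivial R and a non-zero derivative -/

namespace CircleToy

open AnalyticSmoke.Line (places ell ell_φ₀)

/-- Φ ↦ 𝒯_Φ = Φ·id is operator-norm continuous (the operator form of [SETUP D4], here a fact). -/
theorem hTc : Continuous fun Φ : ℂ => core.TΦc Φ := by
  show Continuous fun Φ : ℂ => Φ • ContinuousLinearMap.id ℂ ℂ
  exact continuous_id.smul continuous_const

/-- **`FockThetaBridge` over the circle toy**, from the smooth bridge and `hTc` by `FockThetaBridge.ofSmooth`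
(KERNEL route [D5′] + operator-norm [D4] ⇒ [D5‴]); every field PROVED. -/
def thetaBridge : FockThetaBridge core torus pointed := FockThetaBridge.ofSmooth smoothBridge hTc

/-- (Ported verbatim from the HodgeCMPerL package; no docstring in the source.) -/
theorem nonempty_thetaBridge : Nonempty (FockThetaBridge core torus pointed) := ⟨thetaBridge⟩

/-- (Ported verbatim from the HodgeCMPerL package; no docstring in the source.) -/
theorem thetaBridge_e (s : ℝ) : thetaBridge.e () s = Circle.exp s := rfl

/-- (Ported verbatim from the HodgeCMPerL package; no docstring in the source.) -/
theorem thetaBridge_ins (φ : places.F) : thetaBridge.ins () φ = ell φ := rfl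

/-- (Ported verbatim from the HodgeCMPerL package; no docstring in the source.) -/
theorem thetaBridge_XR_apply (φ : places.F) : thetaBridge.XR () φ = Complex.I • φ := rfl

/-- **The theta vector of the circle toy is the CONJUGATE**: θ_{Φ,p} = conj Φ (⟪conj Φ, v⟫ = Φv = 𝒯_Φ(v)(p)). -/
theorem rieszTheta_circle (p : pointed.Pt) (Φ : ℂ) : rieszTheta core pointed p Φ = starRingEnd ℂ Φ := by
  apply rieszTheta_eq_of_inner
  intro v
  rw [evalPt_apply, TΦc_apply, RCLike.inner_apply, RCLike.conj_conj, mul_comm]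

/-- **[D5‴] concretely, read off the kernel-derived field**: s ↦ R(e(s)) conj(ℓφ) has derivative conj(ℓ(iφ)) at 0. -/
theorem thetaC1_conj (φ : places.F) :
    HasDerivAt (fun s : ℝ => core.R (Circle.exp s) (starRingEnd ℂ (ell φ)))
      (starRingEnd ℂ (Complex.I * ell φ)) 0 := by
  have h := thetaBridge.thetaC1 () () φ ()
  simp only [thetaBridge_e, thetaBridge_ins, thetaBridge_XR_apply, rieszTheta_circle, map_smul, smul_eq_mul] at h
  exact h

/-- The same derivative computed DIRECTLY (R(e(s))c = e(s)⁻¹c = conj(e(s))·c for e(s) on the circle), agreeing with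
`thetaC1_conj`: d/ds|₀ e^{-is}·conj(c) = −i·conj(c) = conj(i c). -/
theorem thetaC1_direct (c : ℂ) :
    HasDerivAt (fun s : ℝ => core.R (Circle.exp s) (starRingEnd ℂ c)) (starRingEnd ℂ (Complex.I * c)) 0 := by
  have h1 := hasDerivAt_coe_exp_mul c
  have h2 : HasDerivAt (fun s : ℝ => starRingEnd ℂ ((Circle.exp s : ℂ) * c)) (starRingEnd ℂ (Complex.I * c)) 0 :=
    (Complex.conjCLE.toContinuousLinearMap.restrictScalars ℝ |>.hasFDerivAt).comp_hasDerivAt 0 h1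
  refine h2.congr_of_eventuallyEq (Eventually.of_forall fun s => ?_)
  show core.R (Circle.exp s) (starRingEnd ℂ c) = starRingEnd ℂ ((Circle.exp s : ℂ) * c)
  rw [R_apply, map_mul, ← Circle.coe_inv_eq_conj]

/-- **The [D5‴] derivative is NON-ZERO** at φ⁰: conj(ℓ(iφ⁰)) = conj i = −i ≠ 0. -/
theorem thetaC1_value_ne_zero : starRingEnd ℂ (Complex.I * ell places.φ₀) ≠ 0 := by
  rw [ell_φ₀, mul_one]
  exact (map_ne_zero _).mpr Complex.I_ne_zero

/-- The scalar derivative re-derived through the theta bridge has the value i (as through the smooth bridge). -/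
theorem hFpt_value_theta :
    HasDerivAt (fun s : ℝ => pointed.evalPt () (core.TΦc (core.omg (thetaBridge.e () s) (thetaBridge.ins () places.φ₀)) 1))
      Complex.I 0 := by
  refine (thetaBridge.toScalarBridge.hFpt () () places.φ₀ () 1).congr_deriv ?_
  show pointed.evalPt () (core.TΦc (ell ((Complex.I • (LinearMap.id : places.F →ₗ[ℂ] places.F)) places.φ₀)) 1) =
    Complex.I
  rw [LinearMap.smul_apply, LinearMap.id_apply, map_smul, ell_φ₀, smul_eq_mul, mul_one, evalPt_apply, TΦc_apply,
    mul_one]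

/-- The chart's joint eigenvector predicate fires through the theta bridge. -/
theorem orbitCore_eigen_theta : thetaBridge.toOrbitCore.Eigen () :=
  ⟨1, Submodule.mem_top, one_ne_zero, fun t => by
    show core.R ((1 : places.Tg →* Circle) t) 1 = (1 : places.Tg →* ℂ) t • (1 : ℂ)
    rw [MonoidHom.one_apply, MonoidHom.one_apply, one_smul, R_apply, inv_one, Circle.coe_one, one_mul]⟩

/-- **N29's conclusion fires through the circle toy's theta bridge** (premise `𝒯_1 1 = 1 ≠ 0`). -/
theorem H_occ_fires_theta : torus.wOccurs () :=
  thetaBridge.H_occ 1 () ⟨1, Submodule.mem_top, by rw [TΦ_one_one]; exact one_ne_zero⟩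

end CircleToy

end OrbitSmoke
end ArchC
end PerL34
end HodgeCM

end
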